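import Summits.Ventures.DiscreteObjects.UnitDistance.PadicHigherReduction
import HarnessLib

/-!
# The reduction graphs modulo EVERY power: `χ(G_k(3)) = 3`, `χ(G_k(7)) = 4`, `4 ≤ χ(G_k(11)), χ(G_k(19)) ≤ 5` (all `k ≥ 1`)
(cell `pub-namedobj`, target (U), seat udg g19 — companion of `PadicHigherReduction.lean`)

Framing (verbatim for the cell): lottery ticket; floor = certified bounds/negative ranges.

`G_k(p) := unitCircleGraph (ZMod (p^k)) = Cay((ℤ/p^k)², {a² + b² = 1})` is sandwiched between the `p`-adic plane and the residue plane: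
`χ(unitCircleGraph ℚ_p) ≤ χ(G_k(p)) ≤ χ(G_1(p)) = χ(UD(𝔽_p²))` (`PadicHigherReduction.lean`: Madore Prop. 3.5 at order `k`, and the ring map
`ℤ/p^k → ℤ/p`).  With the `p`-adic plane values of that file (`χ(ℚ₃²) = 3`, `χ(ℚ₇²) = 4`, `4 ≤ χ(ℚ₁₁²), χ(ℚ₁₉²) ≤ 5`) this pins down, for EVERY
`k ≥ 1` and without any certificate: `χ(G_k(3)) = 3`, `χ(G_k(7)) = 4` (the cell's `RingPlaneZMod49.lean` was `k = 2` by a RUP certificate), and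
`4 ≤ χ(G_k(11)) ≤ 5`, `4 ≤ χ(G_k(19)) ≤ 5`.  The open cases are exactly the ones that matter for the quadratic rows `47, 311, 335`: `G_k(11)` needs
`5` colours for `k = 1, 2` (certificates), `G_1(19)` needs `5`; seat udg g19's hub census (HOME pub-namedobj-udg-g19/FAMILIES-U19.md) finds that every
symmetric reduction of `G_3(11)` and of `G_2(19)` needs `5` as well, and conjectures `χ(G_k(11)) = χ(G_k(19)) = 5` for all `k` via the lift identity
`α(G_{k+1}(p)) = p²·α(G_k(p))` (exact at `p = 3`).  Last theorem: the converse row statement — if `χ(ℚ(√47)²) = 5` then both `p`-adic planes need `5`.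
Nothing here is cited as new mathematics beyond the cell's own kernel facts; PROVISIONAL (values of `χ(ℚ_p²)` not found in print, Madore 2015 poses the question).
-/

noncomputable section

namespace Summit.Ventures.DiscreteObjects.UnitDistance

open SimpleGraph IntermediateField
open scoped IntermediateField


/-- A graph with chromatic number (at least) `n + 1` is not `n`-colourable. -/
theorem not_colorable_of_lt_chromaticNumber {W : Type*} {H : SimpleGraph W} {n : ℕ}
    (h : (n : ℕ∞) < H.chromaticNumber) : ¬ H.Colorable n :=
  fun hc => (lt_irrefl _) (lt_of_le_of_lt hc.chromaticNumber_le h)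

/-- `ZMod 3`, `ZMod 7`, `ZMod 11`, `ZMod 19` are nontrivial (instances for the ring homomorphisms `ZMod (p^k) → ZMod p`). -/
instance factOneLtThree : Fact (1 < 3) := ⟨by norm_num⟩
/-- see `factOneLtThree`. -/
instance factOneLtSeven : Fact (1 < 7) := ⟨by norm_num⟩
/-- see `factOneLtThree`. -/
instance factOneLtEleven : Fact (1 < 11) := ⟨by norm_num⟩
/-- see `factOneLtThree`. -/
instance factOneLtNineteen : Fact (1 < 19) := ⟨by norm_num⟩

/-- Downward transport along `ℤ/p^k → ℤ/p`: `G_k(p)` is `n`-colourable whenever `UD(𝔽_p²)` is (`k ≥ 1`). -/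
theorem unitCircleGraph_zmodPow_colorable_of_zmod (p : ℕ) [Fact p.Prime] [Fact (1 < p)] {k : ℕ} (hk : k ≠ 0) {n : ℕ}
    (hZ : (unitCircleGraph (ZMod p)).Colorable n) : (unitCircleGraph (ZMod (p ^ k))).Colorable n :=
  unitCircleGraph_colorable_of_ringHom (ZMod.castHom (dvd_pow_self p hk) (ZMod p)) hZ

/-- Upward transport from the `p`-adic plane: if `χ(unitCircleGraph ℚ_p) > n` then no `G_k(p)` is `n`-colourable (`p ≡ 3 (mod 4)`, `k ≥ 1`). -/
theorem not_colorable_unitCircleGraph_zmodPow_of_padic (p : ℕ) [Fact p.Prime] (h4 : p % 4 = 3) {k : ℕ} (hk : k ≠ 0)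
    {n : ℕ} (hQ : ¬ (unitCircleGraph ℚ_[p]).Colorable n) : ¬ (unitCircleGraph (ZMod (p ^ k))).Colorable n :=
  fun h => hQ (unitCircleGraph_padic_colorable_of_zmodPow p h4 hk h)

/-- EVERY ORDER AT `p = 3`: `χ(unitCircleGraph (ℤ/3^k)) = 3` for all `k ≥ 1`. -/
theorem chromaticNumber_unitCircleGraph_zmodPow3 {k : ℕ} (hk : k ≠ 0) :
    (unitCircleGraph (ZMod (3 ^ k))).chromaticNumber = 3 := by
  refine chromaticNumber_eq_three_of_sandwich ?_ (unitCircleGraph_zmodPow_colorable_of_zmod 3 hk unitCircleGraph_zmod3_colorable_three)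
  refine not_colorable_unitCircleGraph_zmodPow_of_padic 3 (by norm_num) hk (not_colorable_of_lt_chromaticNumber ?_)
  rw [chromaticNumber_unitCircleGraph_padic3]; norm_num

/-- EVERY ORDER AT `p = 7`: `χ(unitCircleGraph (ℤ/7^k)) = 4` for all `k ≥ 1` (the cell's `RingPlaneZMod49.lean` is `k = 2` by certificate; here all `k`,
certificate-free: lower bound through `χ(ℚ₇²) = 4`, upper bound by reduction to `UD(𝔽₇²)`). -/
theorem chromaticNumber_unitCircleGraph_zmodPow7 {k : ℕ} (hk : k ≠ 0) :
    (unitCircleGraph (ZMod (7 ^ k))).chromaticNumber = 4 := by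
  refine chromaticNumber_eq_four_of_sandwich ?_ (unitCircleGraph_zmodPow_colorable_of_zmod 7 hk unitCircleGraph_zmod7_colorable_four)
  refine not_colorable_unitCircleGraph_zmodPow_of_padic 7 (by norm_num) hk (not_colorable_of_lt_chromaticNumber ?_)
  rw [chromaticNumber_unitCircleGraph_padic7]; norm_num

/-- EVERY ORDER AT `p = 11`: `4 ≤ χ(unitCircleGraph (ℤ/11^k)) ≤ 5` for all `k ≥ 1`.  (`= 5` for `k = 1, 2` by the cell's certificates; whether some `k ≥ 3`
gives `4` is exactly the open question behind the rows `47, 311, 335` — seat udg g19's census: every symmetric reduction of `k = 3` needs `5`.) -/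
theorem chromaticNumber_unitCircleGraph_zmodPow11_bounds {k : ℕ} (hk : k ≠ 0) :
    4 ≤ (unitCircleGraph (ZMod (11 ^ k))).chromaticNumber ∧ (unitCircleGraph (ZMod (11 ^ k))).chromaticNumber ≤ 5 := by
  refine ⟨?_, (unitCircleGraph_zmodPow_colorable_of_zmod 11 hk unitCircleGraph_zmod11_colorable_five).chromaticNumber_le⟩
  have h3 : ¬ (unitCircleGraph (ZMod (11 ^ k))).Colorable 3 :=
    not_colorable_unitCircleGraph_zmodPow_of_padic 11 (by norm_num) hk (not_colorable_of_lt_chromaticNumber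
      (lt_of_lt_of_le (by norm_num) chromaticNumber_unitCircleGraph_padic11_bounds.1))
  by_contra hlt
  have hlt' : (unitCircleGraph (ZMod (11 ^ k))).chromaticNumber < (3 : ℕ∞) + 1 := lt_of_not_ge hlt
  exact h3 (chromaticNumber_le_iff_colorable.mp (Order.le_of_lt_add_one hlt'))

/-- EVERY ORDER AT `p = 19`: `4 ≤ χ(unitCircleGraph (ℤ/19^k)) ≤ 5` for all `k ≥ 1` (`= 5` for `k = 1` by certificate; `k = 2` undecided, every symmetric
reduction of it needs `5`, seat udg g19). -/
theorem chromaticNumber_unitCircleGraph_zmodPow19_bounds {k : ℕ} (hk : k ≠ 0) :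
    4 ≤ (unitCircleGraph (ZMod (19 ^ k))).chromaticNumber ∧ (unitCircleGraph (ZMod (19 ^ k))).chromaticNumber ≤ 5 := by
  refine ⟨?_, (unitCircleGraph_zmodPow_colorable_of_zmod 19 hk unitCircleGraph_zmod19_colorable_five).chromaticNumber_le⟩
  have h3 : ¬ (unitCircleGraph (ZMod (19 ^ k))).Colorable 3 :=
    not_colorable_unitCircleGraph_zmodPow_of_padic 19 (by norm_num) hk (not_colorable_of_lt_chromaticNumber
      (lt_of_lt_of_le (by norm_num) chromaticNumber_unitCircleGraph_padic19_bounds.1))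
  by_contra hlt
  have hlt' : (unitCircleGraph (ZMod (19 ^ k))).chromaticNumber < (3 : ℕ∞) + 1 := lt_of_not_ge hlt
  exact h3 (chromaticNumber_le_iff_colorable.mp (Order.le_of_lt_add_one hlt'))

/-- The converse direction of the row statements: if the row `47` turns out to be `5`, then BOTH `p`-adic planes and every `G_k(11)`, `G_k(19)` need five
colours (`χ(ℚ(√47)²) = 5 ⇒ χ(ℚ₁₁²) = χ(ℚ₁₉²) = 5`). -/
theorem chromaticNumber_padic11_padic19_eq_five_of_sqrt47
    (h : (planeUnitDistanceGraph.induce (fieldPoints ℚ⟮Real.sqrt 47⟯)).chromaticNumber = 5) :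
    (unitCircleGraph ℚ_[11]).chromaticNumber = 5 ∧ (unitCircleGraph ℚ_[19]).chromaticNumber = 5 := by
  have h4 : ¬ (planeUnitDistanceGraph.induce (fieldPoints ℚ⟮Real.sqrt 47⟯)).Colorable 4 :=
    not_colorable_of_lt_chromaticNumber (by rw [h]; norm_num)
  obtain ⟨ι⟩ := nonempty_ringHom_sqrt_padic 11 (by norm_num) 47 (by decide)
  obtain ⟨ι'⟩ := nonempty_ringHom_sqrt_padic 19 (by norm_num) 47 (by decide)
  have h11 := not_colorable_unitCircleGraph_of_ringHom _ ι h4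
  have h19 := not_colorable_unitCircleGraph_of_ringHom _ ι' h4
  refine ⟨le_antisymm chromaticNumber_unitCircleGraph_padic11_bounds.2 ?_, le_antisymm chromaticNumber_unitCircleGraph_padic19_bounds.2 ?_⟩
  · by_contra hlt
    have hlt' : (unitCircleGraph ℚ_[11]).chromaticNumber < (4 : ℕ∞) + 1 := lt_of_not_ge hlt
    exact h11 (chromaticNumber_le_iff_colorable.mp (Order.le_of_lt_add_one hlt'))
  · by_contra hlt
    have hlt' : (unitCircleGraph ℚ_[19]).chromaticNumber < (4 : ℕ∞) + 1 := lt_of_not_ge hlt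
    exact h19 (chromaticNumber_le_iff_colorable.mp (Order.le_of_lt_add_one hlt'))


end Summit.Ventures.DiscreteObjects.UnitDistance

end
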